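import Summits.Ventures.PercRepro.C026HGraph
import Summits.Ventures.PercRepro.C026FactorTwo

/-!
# The equality locus of the D-free inequality, I: `CSeparated` and Theorem E (i) (p5, gen 14)

mine-3's criterion `F2` (proofs/MINE3-EQUALITY-LOCUS.md §2–§3) in graph form: `CSeparated a b c` — the
component of the mark `c` in the underlying graph (every edge open) contains neither `a` nor `b`.

* **Theorem E (i)** (`dFree_counts_eq_zero_of_cSeparated`): every H-step joins two vertices of one
  component of the underlying graph, so under `CSeparated` an H-walk from `c` never reaches `a` or `b`,
  and an H-walk from `a` never meets `M` (it is an open walk, so it never reaches `b` in `bot`): in every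
  configuration the three events of the D-free inequality (`BotM`, `O1`, `O2`) are false — equality
  `0 = 0 + 0`, on every multigraph.
* The witness configurations `offAt x c` (every edge open except those at `x` and at `c`) and the two
  walk lemmas (`exists_adj_conn_offAtC`, `conn_offAtC_split`) used by part II for Theorem E (ii).
-/

namespace PercRepro

open Finset

namespace MultiGraph

section EqualityLocus

variable {V E : Type*} (G : MultiGraph V E)

/-- The configuration with every edge open (the underlying graph). -/
def fullConfig : Config E := fun _ => true

/-- **mine-3's criterion `F2` in graph form**: the component of `c` in the underlying graph (every
edge open) contains neither `a` nor `b` — equivalently (no mark–mark edge at `c`), every component of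
`G − {a, b, c}` with an edge to `c` has no edge to `a` and no edge to `b`. -/
def CSeparated (a b c : V) : Prop :=
  ¬ G.Conn (fullConfig (E := E)) c a ∧ ¬ G.Conn (fullConfig (E := E)) c b

open Classical in
/-- The configuration with every edge open except those at `x` and at `c`. -/
noncomputable def offAt (x c : V) : Config E := fun e =>
  decide (G.fst e ≠ x ∧ G.snd e ≠ x ∧ G.fst e ≠ c ∧ G.snd e ≠ c)

open Classical in
/-- The configuration with every edge open except those at `c`. -/
noncomputable def offAtC (c : V) : Config E := fun e => decide (G.fst e ≠ c ∧ G.snd e ≠ c)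

variable {G}

/-- Every configuration is below the full one. -/
theorem le_fullConfig (ω : Config E) : ω ≤ fullConfig (E := E) := fun _ => Bool.le_true _

/-- An edge joining two vertices is an open adjacency of the full configuration. -/
theorem openAdj_full_of_joins {e : E} {u v : V} (hj : G.Joins e u v) :
    G.OpenAdj (fullConfig (E := E)) u v :=
  ⟨e, rfl, hj⟩

/-- **Every H-step joins two vertices of one component of the underlying graph.** -/
theorem hAdj_conn_full {S : Config E} {c u v : V} (h : G.HAdj S c u v) :
    G.Conn (fullConfig (E := E)) u v := by
  rcases h with ⟨_, _, e, _, hj⟩ | ⟨_, e, hj⟩ | ⟨_, _, hc⟩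
  · exact Conn.of_openAdj (openAdj_full_of_joins hj)
  · exact Conn.of_openAdj (openAdj_full_of_joins hj)
  · exact hc.mono (le_fullConfig S)

/-- **Every H-walk stays in one component of the underlying graph.** -/
theorem hConn_conn_full {S : Config E} {c u v : V} (h : G.HConn S c u v) :
    G.Conn (fullConfig (E := E)) u v := by
  unfold HConn at h
  induction h with
  | refl => exact Relation.ReflTransGen.refl
  | tail _ hxy ih => exact ih.trans (hAdj_conn_full hxy)

/-! ### Theorem E (i): under `CSeparated` the three events vanish -/

/-- Under `CSeparated`, no H-walk from `c` reaches `a`. -/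
theorem not_hConn_c_a_of_cSeparated {a b c : V} (hsep : G.CSeparated a b c) (S : Config E) :
    ¬ G.HConn S c c a := fun h => hsep.1 (hConn_conn_full h)

/-- Under `CSeparated`, no H-walk from `c` reaches `b`. -/
theorem not_hConn_c_b_of_cSeparated {a b c : V} (hsep : G.CSeparated a b c) (S : Config E) :
    ¬ G.HConn S c c b := fun h => hsep.2 (hConn_conn_full h)

/-- **Under `CSeparated`, `a` and `b` are never H-connected when they are not connected**: an H-walk
from `a` can only use steps of the third kind (it never meets `M`), i.e. it is an open walk. -/
theorem not_hConn_a_b_of_cSeparated {a b c : V} (hsep : G.CSeparated a b c) {S : Config E}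
    (hab : ¬ G.Conn S a b) : ¬ G.HConn S c a b := by
  intro h
  unfold HConn at h
  have key : ∀ v, Relation.ReflTransGen (G.HAdj S c) a v → G.Conn S a v ∧ v ∉ G.cluster S c := by
    intro v hv
    induction hv with
    | refl =>
      refine ⟨Relation.ReflTransGen.refl, fun hm => hsep.1 ?_⟩
      exact (G.mem_cluster.1 hm).mono (le_fullConfig S)
    | @tail x y _ hxy ih =>
      obtain ⟨hax, hxM⟩ := ih
      rcases hxy with ⟨hxM', _⟩ | ⟨hiff, e, hj⟩ | ⟨_, hyM, hxy⟩
      · exact absurd hxM' hxM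
      · have hyM : y ∈ G.cluster S c := by
          by_contra hy
          exact hxM (hiff.2 hy)
        exfalso
        apply hsep.1
        have h1 : G.Conn (fullConfig (E := E)) c y := (G.mem_cluster.1 hyM).mono (le_fullConfig S)
        have h2 : G.Conn (fullConfig (E := E)) x y := Conn.of_openAdj (openAdj_full_of_joins hj)
        have h3 : G.Conn (fullConfig (E := E)) a x := hax.mono (le_fullConfig S)
        exact h1.trans (h2.symm.trans h3.symm)
      · exact ⟨hax.trans hxy, hyM⟩
  exact hab (key b h).1

/-- Under `CSeparated`, no configuration is in `BotM` (`bot` with `a ~_H b`). -/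
theorem not_botM_of_cSeparated {a b c : V} (hsep : G.CSeparated a b c) (ω : Config E) :
    ¬ G.BotM ω a b c := fun ⟨hbot, hconn⟩ =>
  not_hConn_a_b_of_cSeparated hsep hbot.1 ((G.conn_kSwap_iff_hConn ω c a b).1 hconn)

/-- Under `CSeparated`, no configuration is in `O1` (`bot` with `c ~_H a` avoiding `L`). -/
theorem not_o1_of_cSeparated {a b c : V} (hsep : G.CSeparated a b c) (ω : Config E) :
    ¬ G.O1 ω a b c := fun ⟨hbot, hcell⟩ =>
  not_hConn_c_a_of_cSeparated hsep ω (G.hConn_of_hConnAvoid ((G.cellAC_kSwapSealed_iff hbot).1 hcell))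

/-- Under `CSeparated`, no configuration is in `O2` (`bot` with `c ~_H b` avoiding `K`). -/
theorem not_o2_of_cSeparated {a b c : V} (hsep : G.CSeparated a b c) (ω : Config E) :
    ¬ G.O2 ω a b c := fun ⟨hbot, hcell⟩ =>
  not_hConn_c_b_of_cSeparated hsep ω (G.hConn_of_hConnAvoid ((G.cellBC_kSwapSealed_iff hbot).1 hcell))

open Classical in
/-- **Theorem E (i)**: under `CSeparated` all three counts of the D-free inequality vanish — the
inequality holds with equality `0 = 0 + 0`, for every multigraph. -/
theorem dFree_counts_eq_zero_of_cSeparated [Fintype E] {a b c : V} (hsep : G.CSeparated a b c) :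
    (univ.filter fun ω : Config E => G.BotM ω a b c).card = 0 ∧
      (univ.filter fun ω : Config E => G.O1 ω a b c).card = 0 ∧
        (univ.filter fun ω : Config E => G.O2 ω a b c).card = 0 := by
  refine ⟨?_, ?_, ?_⟩ <;> rw [Finset.card_eq_zero, Finset.filter_eq_empty_iff]
  · exact fun ω _ => not_botM_of_cSeparated hsep ω
  · exact fun ω _ => not_o1_of_cSeparated hsep ω
  · exact fun ω _ => not_o2_of_cSeparated hsep ω

/-! ### The witness configurations -/

/-- Edges at a closed vertex: a vertex all of whose edges are closed is its own cluster. -/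
theorem conn_eq_of_closedAt {ω : Config E} {z : V} (hz : ∀ e, ω e = true → G.fst e ≠ z ∧ G.snd e ≠ z)
    {v : V} (h : G.Conn ω z v) : v = z := by
  refine Conn.induction (G := G) (motive := fun w => w = z) rfl ?_ h
  intro x y _ hxy hx
  subst hx
  obtain ⟨e, he, hj⟩ := hxy
  exfalso
  rcases hj with ⟨h1, _⟩ | ⟨_, h2⟩
  · exact (hz e he).1 h1
  · exact (hz e he).2 h2

/-- An edge is open in `offAt x c` iff it is at neither `x` nor `c`. -/
theorem offAt_eq_true_iff {x c : V} (e : E) :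
    G.offAt x c e = true ↔ (G.fst e ≠ x ∧ G.snd e ≠ x ∧ G.fst e ≠ c ∧ G.snd e ≠ c) := by
  simp [offAt]

/-- An edge is open in `offAtC c` iff it is not at `c`. -/
theorem offAtC_eq_true_iff {c : V} (e : E) :
    G.offAtC c e = true ↔ (G.fst e ≠ c ∧ G.snd e ≠ c) := by
  simp [offAtC]

/-- In `offAt x c` every edge at `x` is closed. -/
theorem offAt_closedAt_x (x c : V) : ∀ e, G.offAt x c e = true → G.fst e ≠ x ∧ G.snd e ≠ x :=
  fun e he => ⟨((G.offAt_eq_true_iff e).1 he).1, ((G.offAt_eq_true_iff e).1 he).2.1⟩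

/-- In `offAt x c` every edge at `c` is closed. -/
theorem offAt_closedAt_c (x c : V) : ∀ e, G.offAt x c e = true → G.fst e ≠ c ∧ G.snd e ≠ c :=
  fun e he => ⟨((G.offAt_eq_true_iff e).1 he).2.2.1, ((G.offAt_eq_true_iff e).1 he).2.2.2⟩

/-- In `offAt x c` the cluster of `x` is `{x}`. -/
theorem conn_offAt_x_eq {x c v : V} (h : G.Conn (G.offAt x c) x v) : v = x :=
  conn_eq_of_closedAt (G.offAt_closedAt_x x c) h

/-- In `offAt x c` the cluster of `c` is `{c}`. -/
theorem conn_offAt_c_eq {x c v : V} (h : G.Conn (G.offAt x c) c v) : v = c :=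
  conn_eq_of_closedAt (G.offAt_closedAt_c x c) h

/-- `offAt b c` is a `bot` configuration for three distinct marks. -/
theorem isBot_offAt {a b c : V} (hab : a ≠ b) (hac : a ≠ c) (hbc : b ≠ c) :
    G.IsBot (G.offAt b c) a b c :=
  ⟨fun h => hab (conn_offAt_x_eq h.symm), fun h => hac (conn_offAt_c_eq h.symm),
    fun h => hbc (conn_offAt_c_eq h.symm)⟩

/-- `offAt a c` is a `bot` configuration for three distinct marks. -/
theorem isBot_offAt' {a b c : V} (hab : a ≠ b) (hac : a ≠ c) (hbc : b ≠ c) :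
    G.IsBot (G.offAt a c) a b c :=
  ⟨fun h => hab (conn_offAt_x_eq h).symm, fun h => hac (conn_offAt_c_eq h.symm),
    fun h => hbc (conn_offAt_c_eq h.symm)⟩

/-- An edge joining two vertices different from `z` is not at `z`. -/
theorem ne_of_joins {e : E} {u v z : V} (hj : G.Joins e u v) (hu : u ≠ z) (hv : v ≠ z) :
    G.fst e ≠ z ∧ G.snd e ≠ z := by
  rcases hj with ⟨h1, h2⟩ | ⟨h1, h2⟩
  · exact ⟨h1 ▸ hu, h2 ▸ hv⟩
  · exact ⟨h1 ▸ hv, h2 ▸ hu⟩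

/-- **Last exit from `c`**: an all-open walk from `c` to `v ≠ c` ends with a walk avoiding the edges at
`c` that starts at a neighbour `u ≠ c` of `c`. -/
theorem exists_adj_conn_offAtC {c v : V} (h : G.Conn (fullConfig (E := E)) c v) (hv : v ≠ c) :
    ∃ u, G.OpenAdj (fullConfig (E := E)) c u ∧ u ≠ c ∧ G.Conn (G.offAtC c) u v := by
  have key : ∀ w, G.Conn (fullConfig (E := E)) c w →
      w = c ∨ ∃ u, G.OpenAdj (fullConfig (E := E)) c u ∧ u ≠ c ∧ G.Conn (G.offAtC c) u w := by
    intro w hw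
    refine Conn.induction (G := G) (motive := fun w => w = c ∨ ∃ u,
      G.OpenAdj (fullConfig (E := E)) c u ∧ u ≠ c ∧ G.Conn (G.offAtC c) u w) (Or.inl rfl) ?_ hw
    intro x y _ hxy ih
    by_cases hy : y = c
    · exact Or.inl hy
    by_cases hx : x = c
    · subst hx
      exact Or.inr ⟨y, hxy, hy, Relation.ReflTransGen.refl⟩
    rcases ih with hxc | ⟨u, hcu, huc, hux⟩
    · exact absurd hxc hx
    · refine Or.inr ⟨u, hcu, huc, hux.trans (Conn.of_openAdj ?_)⟩
      obtain ⟨e, _, hj⟩ := hxy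
      refine ⟨e, ?_, hj⟩
      rw [G.offAtC_eq_true_iff]
      exact ne_of_joins hj hx hy
  rcases key v h with hvc | hu
  · exact absurd hvc hv
  · exact hu

/-- **The first mark on a walk**: a walk from `u` to `x` avoiding the edges at `c` either avoids the
edges at `y` as well, or reaches `y` avoiding the edges at `x`. -/
theorem conn_offAtC_split {c x y u : V} (hux : u ≠ x) (huy : u ≠ y) (hxy : x ≠ y)
    (h : G.Conn (G.offAtC c) u x) :
    G.Conn (G.offAt y c) u x ∨ G.Conn (G.offAt x c) u y := by
  have key : ∀ w, G.Conn (G.offAtC c) u w → G.Conn (G.offAt y c) u x ∨ G.Conn (G.offAt x c) u y ∨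
      (w ≠ x ∧ w ≠ y ∧ G.Conn (G.offAt y c) u w ∧ G.Conn (G.offAt x c) u w) := by
    intro w hw
    refine Conn.induction (G := G) (motive := fun w => G.Conn (G.offAt y c) u x ∨
      G.Conn (G.offAt x c) u y ∨
        (w ≠ x ∧ w ≠ y ∧ G.Conn (G.offAt y c) u w ∧ G.Conn (G.offAt x c) u w))
      (Or.inr (Or.inr ⟨hux, huy, Relation.ReflTransGen.refl, Relation.ReflTransGen.refl⟩)) ?_ hw
    intro p q _ hpq ih
    rcases ih with h1 | h2 | ⟨hpx, hpy, hp1, hp2⟩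
    · exact Or.inl h1
    · exact Or.inr (Or.inl h2)
    obtain ⟨e, he, hj⟩ := hpq
    have hec := (G.offAtC_eq_true_iff e).1 he
    by_cases hqy : q = y
    · subst hqy
      refine Or.inr (Or.inl (hp2.trans (Conn.of_openAdj ⟨e, ?_, hj⟩)))
      rw [G.offAt_eq_true_iff]
      exact ⟨(ne_of_joins hj hpx hxy.symm).1, (ne_of_joins hj hpx hxy.symm).2, hec.1, hec.2⟩
    by_cases hqx : q = x
    · subst hqx
      refine Or.inl (hp1.trans (Conn.of_openAdj ⟨e, ?_, hj⟩))
      rw [G.offAt_eq_true_iff]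
      exact ⟨(ne_of_joins hj hpy hxy).1, (ne_of_joins hj hpy hxy).2, hec.1, hec.2⟩
    refine Or.inr (Or.inr ⟨hqx, hqy, hp1.trans (Conn.of_openAdj ⟨e, ?_, hj⟩),
      hp2.trans (Conn.of_openAdj ⟨e, ?_, hj⟩)⟩)
    · rw [G.offAt_eq_true_iff]
      exact ⟨(ne_of_joins hj hpy hqy).1, (ne_of_joins hj hpy hqy).2, hec.1, hec.2⟩
    · rw [G.offAt_eq_true_iff]
      exact ⟨(ne_of_joins hj hpx hqx).1, (ne_of_joins hj hpx hqx).2, hec.1, hec.2⟩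
  rcases key x h with h1 | h2 | ⟨hxx, _⟩
  · exact Or.inl h1
  · exact Or.inr h2
  · exact absurd rfl hxx

end EqualityLocus

end MultiGraph

end PercRepro
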